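import Summits.Ventures.HodgeRepro2.T5SU11JacobiOrbitMoments

/-!
# The first two moments of the orbit radius in rational closed form, and their rates: `k⟨|g·0|²⟩ = 2 + μ/k`,
`k²⟨|g·0|⁴⟩ = (8k² + (16 + 8μ)k + 8μ + μ²)/(k + 2)²`, `μ = λ(λ − 2)`

`T5SU11JacobiPhaseMGF` and `T5SU11JacobiOrbitMoments` give `⟨|g·0|²⟩_{k,λ} = 1 − r_k(λ)` and
`⟨|g·0|⁴⟩_{k,λ} = 1 − 2 r_k(λ) + r_k(λ) r_{k+2}(λ)` with `r_k(λ) = 1 − 2/k − μ/k²`, `μ = λ(λ − 2)`. Multiplying out: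

* **`k ⟨|g·0|²⟩_{k,λ} = 2 + μ/k`** (`mul_mean_orbit_sq_eq`), so `|k ⟨|g·0|²⟩ − 2| = |μ|/k` exactly (`abs_mul_mean_orbit_sq_sub_two`);
* **`k² ⟨|g·0|⁴⟩_{k,λ} = (8k² + (16 + 8μ)k + 8μ + μ²)/(k + 2)²`** (`sq_mul_moment_orbit_sq_two_eq`), so
  `k² ⟨|g·0|⁴⟩ − 8 = ((8μ − 16)k + 8μ + μ² − 32)/(k + 2)²` and, on `0 ≤ λ ≤ 2` (`|μ| ≤ 1`),
  **`|k² ⟨|g·0|⁴⟩_{k,λ} − 8| ≤ 65/k`** (`abs_sq_mul_moment_orbit_sq_two_sub_eight_le`);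
* the variance of the rescaled orbit radius `k|g·0|²/2` in closed form,
  **`Var(k|g·0|²/2) = (k² ⟨|g·0|⁴⟩ − (k ⟨|g·0|²⟩)²)/4`** in closed form — stated as
  `(k²/4)(⟨|g·0|⁴⟩ − ⟨|g·0|²⟩²) = ((8k² + (16 + 8μ)k + 8μ + μ²)/(k + 2)² − (2 + μ/k)²)/4` (`sq_div_four_mul_variance_orbit_sq_eq`),
  with **`|Var(k|g·0|²/2) − 1| ≤ 18/k`** on `0 ≤ λ ≤ 2`, `k ≥ 4` (`abs_sq_div_four_mul_variance_orbit_sq_sub_one_le`) —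
  the rate of `T5SU11JacobiPhaseOrbitCovarianceAsymptotic.tendsto_sq_div_four_mul_variance_orbit_sq`.

Nothing is claimed about (N).

Blind lane: Mathlib + the HodgeRepro2 prefix only; no sorry; axioms ⊆ {propext, Classical.choice,
Quot.sound}.
-/

namespace Summit.Ventures.HodgeRepro2.T5SU11JacobiOrbitMomentRate

open MeasureTheory MeasureTheory.Measure Metric Set Filter Topology
open T5SU11Unimodular T5SU11Fibration T5SU11Cartan T5SU11CartanProjection T5HaarCircle
  T5BergmanCoefficient T5SU11FibrationHaar T5SU11SphericalFunction T5SU11SphericalSymmetry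
  T5SU11SphericalBounds T5SU11SphericalContinuous T5SU11JacobiIwasawa T5SU11JacobiTransform
  T5SU11JacobiWeight T5SU11KFiniteMajorantPow T5SU11JacobiWeightRecursion T5SU11JacobiPhaseMGF
  T5SU11JacobiOrbitMoments
open scoped Real

section measure

variable [MeasurableSpace Circle] [BorelSpace Circle]

/-- **`k ⟨|g·0|²⟩_{k,λ} = 2 + λ(λ − 2)/k`** on the ray. -/
theorem mul_mean_orbit_sq_eq {k lam : ℝ} (hk : 1 < k) (h1 : lam < k) (h2 : 2 < k + lam) :
    k * ((∫ g, ‖orbit g‖ ^ 2 * ((1 - ‖orbit g‖ ^ 2) ^ (k / 2) * sph lam g) ∂(nu haarCircle))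
        / ∫ g, (1 - ‖orbit g‖ ^ 2) ^ (k / 2) * sph lam g ∂(nu haarCircle))
      = 2 + lam * (lam - 2) / k := by
  rw [mean_orbit_sq_eq' hk h1 h2]
  have hk0 : k ≠ 0 := by linarith
  field_simp
  ring

/-- **`|k ⟨|g·0|²⟩_{k,λ} − 2| = |λ(λ − 2)|/k`** on the ray: the first orbit moment converges at the exact rate `|μ|/k`. -/
theorem abs_mul_mean_orbit_sq_sub_two {k lam : ℝ} (hk : 1 < k) (h1 : lam < k) (h2 : 2 < k + lam) :
    |k * ((∫ g, ‖orbit g‖ ^ 2 * ((1 - ‖orbit g‖ ^ 2) ^ (k / 2) * sph lam g) ∂(nu haarCircle))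
        / ∫ g, (1 - ‖orbit g‖ ^ 2) ^ (k / 2) * sph lam g ∂(nu haarCircle)) - 2|
      = |lam * (lam - 2)| / k := by
  rw [mul_mean_orbit_sq_eq hk h1 h2, show 2 + lam * (lam - 2) / k - 2 = lam * (lam - 2) / k by ring,
    abs_div, abs_of_pos (by linarith : (0 : ℝ) < k)]

/-- **`k² ⟨|g·0|⁴⟩_{k,λ} = (8k² + (16 + 8μ)k + 8μ + μ²)/(k + 2)²`**, `μ = λ(λ − 2)`, on the ray. -/
theorem sq_mul_moment_orbit_sq_two_eq {k lam : ℝ} (hk : 1 < k) (h1 : lam < k) (h2 : 2 < k + lam) :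
    k ^ 2 * ((∫ g, (‖orbit g‖ ^ 2) ^ 2 * ((1 - ‖orbit g‖ ^ 2) ^ (k / 2) * sph lam g) ∂(nu haarCircle))
        / ∫ g, (1 - ‖orbit g‖ ^ 2) ^ (k / 2) * sph lam g ∂(nu haarCircle))
      = (8 * k ^ 2 + (16 + 8 * (lam * (lam - 2))) * k + 8 * (lam * (lam - 2)) + (lam * (lam - 2)) ^ 2)
        / (k + 2) ^ 2 := by
  rw [moment_orbit_sq_two hk h1 h2, weightRatio_eq (by linarith), weightRatio_eq (by linarith : k + 2 ≠ 0)]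
  have hk0 : k ≠ 0 := by linarith
  have hk2 : k + 2 ≠ 0 := by linarith
  field_simp
  ring

/-- **`|k² ⟨|g·0|⁴⟩_{k,λ} − 8| ≤ 65/k`** for `k > 2`, `0 ≤ λ ≤ 2`. -/
theorem abs_sq_mul_moment_orbit_sq_two_sub_eight_le {k lam : ℝ} (hk : 2 < k) (h0 : 0 ≤ lam) (h2 : lam ≤ 2) :
    |k ^ 2 * ((∫ g, (‖orbit g‖ ^ 2) ^ 2 * ((1 - ‖orbit g‖ ^ 2) ^ (k / 2) * sph lam g) ∂(nu haarCircle))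
        / ∫ g, (1 - ‖orbit g‖ ^ 2) ^ (k / 2) * sph lam g ∂(nu haarCircle)) - 8| ≤ 65 / k := by
  rw [sq_mul_moment_orbit_sq_two_eq (by linarith) (by linarith) (by linarith)]
  set μ : ℝ := lam * (lam - 2) with hμ
  have hμ1 : -1 ≤ μ := by rw [hμ]; nlinarith [sq_nonneg (lam - 1)]
  have hμ0 : μ ≤ 0 := by rw [hμ]; nlinarith
  have hk0 : 0 < k := by linarith
  have hk2 : 0 < (k + 2) ^ 2 := by positivity
  have e : (8 * k ^ 2 + (16 + 8 * μ) * k + 8 * μ + μ ^ 2) / (k + 2) ^ 2 - 8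
      = ((8 * μ - 16) * k + 8 * μ + μ ^ 2 - 32) / (k + 2) ^ 2 := by
    field_simp
    ring
  rw [e, abs_div, abs_of_pos hk2, div_le_div_iff₀ hk2 hk0]
  have hnum : |(8 * μ - 16) * k + 8 * μ + μ ^ 2 - 32| ≤ 24 * k + 40 := by
    rw [abs_le]
    constructor <;> nlinarith
  calc |(8 * μ - 16) * k + 8 * μ + μ ^ 2 - 32| * k ≤ (24 * k + 40) * k :=
        mul_le_mul_of_nonneg_right hnum hk0.le
    _ ≤ 65 * (k + 2) ^ 2 := by nlinarith

/-- **The variance of the rescaled orbit radius in closed form**: on the ray,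
`(k²/4)(⟨|g·0|⁴⟩ − ⟨|g·0|²⟩²) = ((8k² + (16 + 8μ)k + 8μ + μ²)/(k + 2)² − (2 + μ/k)²)/4`. -/
theorem sq_div_four_mul_variance_orbit_sq_eq {k lam : ℝ} (hk : 1 < k) (h1 : lam < k) (h2 : 2 < k + lam) :
    k ^ 2 / 4 * ((∫ g, (‖orbit g‖ ^ 2) ^ 2 * ((1 - ‖orbit g‖ ^ 2) ^ (k / 2) * sph lam g) ∂(nu haarCircle))
          / (∫ g, (1 - ‖orbit g‖ ^ 2) ^ (k / 2) * sph lam g ∂(nu haarCircle))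
        - ((∫ g, ‖orbit g‖ ^ 2 * ((1 - ‖orbit g‖ ^ 2) ^ (k / 2) * sph lam g) ∂(nu haarCircle))
          / (∫ g, (1 - ‖orbit g‖ ^ 2) ^ (k / 2) * sph lam g ∂(nu haarCircle))) ^ 2)
      = ((8 * k ^ 2 + (16 + 8 * (lam * (lam - 2))) * k + 8 * (lam * (lam - 2)) + (lam * (lam - 2)) ^ 2)
          / (k + 2) ^ 2 - (2 + lam * (lam - 2) / k) ^ 2) / 4 := by
  have hA := sq_mul_moment_orbit_sq_two_eq hk h1 h2
  have hB := mul_mean_orbit_sq_eq hk h1 h2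
  rw [← hA, ← hB]
  ring

/-- **`|Var(k|g·0|²/2) − 1| ≤ 18/k`** for `k ≥ 4`, `0 ≤ λ ≤ 2`: the rate of
`T5SU11JacobiPhaseOrbitCovarianceAsymptotic.tendsto_sq_div_four_mul_variance_orbit_sq`. -/
theorem abs_sq_div_four_mul_variance_orbit_sq_sub_one_le {k lam : ℝ} (hk : 4 ≤ k) (h0 : 0 ≤ lam) (h2 : lam ≤ 2) :
    |k ^ 2 / 4 * ((∫ g, (‖orbit g‖ ^ 2) ^ 2 * ((1 - ‖orbit g‖ ^ 2) ^ (k / 2) * sph lam g) ∂(nu haarCircle))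
          / (∫ g, (1 - ‖orbit g‖ ^ 2) ^ (k / 2) * sph lam g ∂(nu haarCircle))
        - ((∫ g, ‖orbit g‖ ^ 2 * ((1 - ‖orbit g‖ ^ 2) ^ (k / 2) * sph lam g) ∂(nu haarCircle))
          / (∫ g, (1 - ‖orbit g‖ ^ 2) ^ (k / 2) * sph lam g ∂(nu haarCircle))) ^ 2) - 1| ≤ 18 / k := by
  have hk2 : 2 < k := by linarith
  have hk0 : 0 < k := by linarith
  rw [sq_div_four_mul_variance_orbit_sq_eq (by linarith) (by linarith) (by linarith)]
  set μ : ℝ := lam * (lam - 2) with hμ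
  have hμ1 : -1 ≤ μ := by rw [hμ]; nlinarith [sq_nonneg (lam - 1)]
  have hμ0 : μ ≤ 0 := by rw [hμ]; nlinarith
  -- `k²⟨|g·0|⁴⟩ − 8 = ((8μ − 16)k + 8μ + μ² − 32)/(k+2)²` and `(2 + μ/k)² − 4 = 4μ/k + μ²/k²`
  have e : ((8 * k ^ 2 + (16 + 8 * μ) * k + 8 * μ + μ ^ 2) / (k + 2) ^ 2 - (2 + μ / k) ^ 2) / 4 - 1
      = (((8 * μ - 16) * k + 8 * μ + μ ^ 2 - 32) / (k + 2) ^ 2 - (4 * μ / k + μ ^ 2 / k ^ 2)) / 4 := by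
    have hk2' : (k + 2) ≠ 0 := by linarith
    have hk0' : k ≠ 0 := by linarith
    field_simp
    ring
  rw [e]
  have hk22 : 0 < (k + 2) ^ 2 := by positivity
  have hA : |((8 * μ - 16) * k + 8 * μ + μ ^ 2 - 32) / (k + 2) ^ 2| ≤ 65 / k := by
    rw [abs_div, abs_of_pos hk22, div_le_div_iff₀ hk22 hk0]
    have hnum : |(8 * μ - 16) * k + 8 * μ + μ ^ 2 - 32| ≤ 24 * k + 40 := by
      rw [abs_le]
      constructor <;> nlinarith
    calc |(8 * μ - 16) * k + 8 * μ + μ ^ 2 - 32| * k ≤ (24 * k + 40) * k :=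
          mul_le_mul_of_nonneg_right hnum hk0.le
      _ ≤ 65 * (k + 2) ^ 2 := by nlinarith
  have hB : |4 * μ / k + μ ^ 2 / k ^ 2| ≤ 5 / k := by
    have h1 : |4 * μ / k| ≤ 4 / k := by
      rw [abs_div, abs_of_pos hk0]
      apply div_le_div_of_nonneg_right _ hk0.le
      rw [abs_le]
      constructor <;> linarith
    have hμsq : μ ^ 2 ≤ 1 := by nlinarith
    have h2' : |μ ^ 2 / k ^ 2| ≤ 1 / k := by
      rw [abs_of_nonneg (by positivity), div_le_div_iff₀ (by positivity) hk0]
      nlinarith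
    calc |4 * μ / k + μ ^ 2 / k ^ 2| ≤ |4 * μ / k| + |μ ^ 2 / k ^ 2| := abs_add_le _ _
      _ ≤ 4 / k + 1 / k := add_le_add h1 h2'
      _ = 5 / k := by ring
  calc |(((8 * μ - 16) * k + 8 * μ + μ ^ 2 - 32) / (k + 2) ^ 2 - (4 * μ / k + μ ^ 2 / k ^ 2)) / 4|
      = |((8 * μ - 16) * k + 8 * μ + μ ^ 2 - 32) / (k + 2) ^ 2 - (4 * μ / k + μ ^ 2 / k ^ 2)| / 4 := by
        rw [abs_div, abs_of_pos (by norm_num : (0 : ℝ) < 4)]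
    _ ≤ (65 / k + 5 / k) / 4 := by
        apply div_le_div_of_nonneg_right _ (by norm_num)
        exact (abs_sub _ _).trans (add_le_add hA hB)
    _ ≤ 18 / k := by
        rw [show (65 / k + 5 / k) / 4 = (70 / 4) / k by ring]
        apply div_le_div_of_nonneg_right _ hk0.le
        norm_num

end measure

end Summit.Ventures.HodgeRepro2.T5SU11JacobiOrbitMomentRate
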